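import Summits.AtomisticToContinuum.BoseEinsteinCondensation.Theorems.BECCutLineWeakDisorderTwoReplicaTransienceBoundInsertionStep
import Literature.Probability.Process.BrownianIncrementSup
import HarnessLib

/-!
# Crux `TwoReplicaTransienceBound` (stmt-AtomisticToContinuum-9687), line `SketchIdeator1` v7:
# the TIME-SLICED sausage penalty — joint measurability and the `y`-integral bound
# (stubs `stub_slicedPenaltyMeasurable`, `stub_slicedPenaltyIntegral`)

Support file (`--supports stmt-AtomisticToContinuum-9687`). In the v7 insertion step the reach of a bath
line within time `t ≤ M h` is covered slice by slice: on the `k`-th slice `[k h, (k+1) h]` the tagged line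
(from `x`, sample `ω₀`) and a bath line (from `y`, sample `ω`) can interact only if `y` lies in the ball

`B_k = B(x + √2 b_{kh}(ω₀) - √2 b_{kh}(ω), R + √2 (S_k(ω₀) + S_k(ω)))`,
`S_k(ω) = Σ_{c<3} incRunSup (k h) h (ω c)`

(the centre moves with the two positions at the slice start; the radius is the range plus the two maximal
increments on the slice). This file proves the two analytic facts about the SLICED PENALTY
`Σ_{k<M} 𝟙_{B_k}(y)` consumed by c3's `insertion_generic`:

* `stub_slicedPenaltyMeasurable` — it is jointly measurable in `(x, ω₀, y, ω)`
  (each slice is the indicator of `{dist(y, centre) ≤ radius}` with measurable centre and radius);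
* `stub_slicedPenaltyIntegral` — its error functional is a sum of ball volumes, whatever the centres:
  `∫ dy ∫ dW(ω) ∫ dW(ω₀) Σ_{k<M} 𝟙_{B_k}(y) ≤ Σ_{k<M} E_{ω₀,ω}[(2(R + √2(S_k(ω₀) + S_k(ω))))³]`
  (the finite sum commutes with the integrals, Tonelli puts `y` innermost, `|B(z, r)| ≤ (2r)³` in `ℝ³`).

The generic Tonelli bookkeeping (`SlicedPenalty.lintegral_le_of_lintegral_le`,
`SlicedPenalty.lintegral_sum_le`) is stated for an arbitrary jointly measurable penalty.
-/

noncomputable section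

open MeasureTheory Filter Set
open scoped ENNReal NNReal Topology BigOperators

namespace Summit.AtomisticToContinuum.BoseEinsteinCondensation.Cruxes.TwoReplicaTransienceBound.TracerDecoupling.SlicedPenalty

open Literature.MathematicalPhysics.QuantumManyBody.BoseGas
open Literature.Probability.Process (brownian incRunSup incRunSup_nonneg measurable_incRunSup' measurable_brownian)
open Summit.AtomisticToContinuum.BoseEinsteinCondensation.Cruxes.TwoReplicaTransienceBound.Insertion
  (volume_closedBall_le)

/-! ### Measurability of one slice -/

/-- `S_{u,h}(ω) = Σ_c incRunSup u h (ω c)` (sum of the three coordinate maximal increments on `[u, u+h]`)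
is measurable in the sample. -/
theorem measurable_sum_incRunSup (u h : ℝ≥0) :
    Measurable fun ω : Fin 3 → (ℝ≥0 → ℝ) => ∑ c, incRunSup u h (ω c) :=
  Finset.measurable_sum _ fun c _ => (measurable_incRunSup' u h).comp (measurable_pi_apply c)

/-- `0 ≤ S_{u,h}(ω)`. -/
theorem sum_incRunSup_nonneg (u h : ℝ≥0) (ω : Fin 3 → (ℝ≥0 → ℝ)) : 0 ≤ ∑ c, incRunSup u h (ω c) :=
  Finset.sum_nonneg fun c _ => incRunSup_nonneg u h (ω c)

/-- The slice radius `R + √2 (S_{u,h}(ω₀) + S_{u,h}(ω))` is nonnegative for `R ≥ 0`. -/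
theorem sliceRadius_nonneg {R : ℝ} (hR : 0 ≤ R) (u h : ℝ≥0) (ω₀ ω : Fin 3 → (ℝ≥0 → ℝ)) :
    0 ≤ R + Real.sqrt 2 * ((∑ c, incRunSup u h (ω₀ c)) + ∑ c, incRunSup u h (ω c)) :=
  add_nonneg hR (mul_nonneg (Real.sqrt_nonneg 2)
    (add_nonneg (sum_incRunSup_nonneg u h ω₀) (sum_incRunSup_nonneg u h ω)))

/-- The displacement at time `u`, `ω ↦ √2 b_u(ω) ∈ ℝ³`, is measurable in the sample. -/
theorem measurable_toLp_brownian (u : ℝ≥0) :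
    Measurable fun ω : Fin 3 → (ℝ≥0 → ℝ) =>
      WithLp.toLp 2 (fun c : Fin 3 => Real.sqrt 2 * brownian u (ω c)) :=
  (WithLp.measurable_toLp 2 _).comp (measurable_pi_lambda _ fun c =>
    ((measurable_brownian u).const_mul _).comp (measurable_pi_apply c))

/-- **Joint measurability of one slice of the penalty**
`(x, ω₀, y, ω) ↦ 𝟙{dist(y, x + √2 b_u(ω₀) - √2 b_u(ω)) ≤ R + √2 (S_{u,h}(ω₀) + S_{u,h}(ω))}`:
the indicator of a sub-level set of measurable functions (`Measurable.dist`, `measurableSet_le`). -/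
theorem measurable_slicePenalty (R : ℝ) (u h : ℝ≥0) :
    Measurable fun q : (Space × (Fin 3 → (ℝ≥0 → ℝ))) × (Space × (Fin 3 → (ℝ≥0 → ℝ))) =>
      (Metric.closedBall
        (q.1.1 + WithLp.toLp 2 (fun c : Fin 3 => Real.sqrt 2 * brownian u (q.1.2 c)) -
          WithLp.toLp 2 (fun c : Fin 3 => Real.sqrt 2 * brownian u (q.2.2 c)))
        (R + Real.sqrt 2 * ((∑ c, incRunSup u h (q.1.2 c)) + ∑ c, incRunSup u h (q.2.2 c)))).indicator
        (fun _ => (1 : ℝ≥0∞)) q.2.1 := by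
  have hr : Measurable fun q : (Space × (Fin 3 → (ℝ≥0 → ℝ))) × (Space × (Fin 3 → (ℝ≥0 → ℝ))) =>
      R + Real.sqrt 2 * ((∑ c, incRunSup u h (q.1.2 c)) + ∑ c, incRunSup u h (q.2.2 c)) :=
    measurable_const.add (measurable_const.mul
      (((measurable_sum_incRunSup u h).comp (measurable_snd.comp measurable_fst)).add
        ((measurable_sum_incRunSup u h).comp (measurable_snd.comp measurable_snd))))
  have hc : Measurable fun q : (Space × (Fin 3 → (ℝ≥0 → ℝ))) × (Space × (Fin 3 → (ℝ≥0 → ℝ))) =>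
      q.1.1 + WithLp.toLp 2 (fun c : Fin 3 => Real.sqrt 2 * brownian u (q.1.2 c)) -
        WithLp.toLp 2 (fun c : Fin 3 => Real.sqrt 2 * brownian u (q.2.2 c)) :=
    ((measurable_fst.comp measurable_fst).add
      ((measurable_toLp_brownian u).comp (measurable_snd.comp measurable_fst))).sub
      ((measurable_toLp_brownian u).comp (measurable_snd.comp measurable_snd))
  have hd : Measurable fun q : (Space × (Fin 3 → (ℝ≥0 → ℝ))) × (Space × (Fin 3 → (ℝ≥0 → ℝ))) =>
      dist q.2.1 (q.1.1 + WithLp.toLp 2 (fun c : Fin 3 => Real.sqrt 2 * brownian u (q.1.2 c)) -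
        WithLp.toLp 2 (fun c : Fin 3 => Real.sqrt 2 * brownian u (q.2.2 c))) :=
    (measurable_fst.comp measurable_snd).dist hc
  have heq : (fun q : (Space × (Fin 3 → (ℝ≥0 → ℝ))) × (Space × (Fin 3 → (ℝ≥0 → ℝ))) =>
      (Metric.closedBall
        (q.1.1 + WithLp.toLp 2 (fun c : Fin 3 => Real.sqrt 2 * brownian u (q.1.2 c)) -
          WithLp.toLp 2 (fun c : Fin 3 => Real.sqrt 2 * brownian u (q.2.2 c)))
        (R + Real.sqrt 2 * ((∑ c, incRunSup u h (q.1.2 c)) + ∑ c, incRunSup u h (q.2.2 c)))).indicator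
        (fun _ => (1 : ℝ≥0∞)) q.2.1) =
      {q : (Space × (Fin 3 → (ℝ≥0 → ℝ))) × (Space × (Fin 3 → (ℝ≥0 → ℝ))) |
        dist q.2.1 (q.1.1 + WithLp.toLp 2 (fun c : Fin 3 => Real.sqrt 2 * brownian u (q.1.2 c)) -
          WithLp.toLp 2 (fun c : Fin 3 => Real.sqrt 2 * brownian u (q.2.2 c))) ≤
        R + Real.sqrt 2 * ((∑ c, incRunSup u h (q.1.2 c)) + ∑ c, incRunSup u h (q.2.2 c))}.indicator
        fun _ => (1 : ℝ≥0∞) := by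
    funext q
    simp only [Set.indicator, Metric.mem_closedBall, Set.mem_setOf_eq]
  rw [heq]
  exact measurable_const.indicator (measurableSet_le hd hr)

/-! ### Tonelli bookkeeping for a jointly measurable penalty -/

/-- **One slice: integrate `y` first.** For a jointly measurable `F : (x, ω₀, y, ω) ↦ F x ω₀ y ω ∈ [0,∞]`
with `∫ F x ω₀ y ω dy ≤ B ω₀ ω` for all samples:
`∫ dy ∫ dW(ω) ∫ dW(ω₀) F ≤ ∫ dW(ω₀) ∫ dW(ω) B` (three Tonelli swaps; all sections are measurable by
composition with measurable maps into the product). -/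
theorem lintegral_le_of_lintegral_le
    (F : Space → (Fin 3 → (ℝ≥0 → ℝ)) → Space → (Fin 3 → (ℝ≥0 → ℝ)) → ℝ≥0∞)
    (hF : Measurable fun q : (Space × (Fin 3 → (ℝ≥0 → ℝ))) × (Space × (Fin 3 → (ℝ≥0 → ℝ))) =>
      F q.1.1 q.1.2 q.2.1 q.2.2)
    (B : (Fin 3 → (ℝ≥0 → ℝ)) → (Fin 3 → (ℝ≥0 → ℝ)) → ℝ≥0∞) (x : Space)
    (hB : ∀ ω₀ ω, ∫⁻ y, F x ω₀ y ω ≤ B ω₀ ω) :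
    ∫⁻ y, ∫⁻ ω, ∫⁻ ω₀, F x ω₀ y ω ∂wienerLine ∂wienerLine ≤
      ∫⁻ ω₀, ∫⁻ ω, B ω₀ ω ∂wienerLine ∂wienerLine := by
  -- (a) for each `y`, swap `ω` and `ω₀`
  have ha : ∀ y, ∫⁻ ω, ∫⁻ ω₀, F x ω₀ y ω ∂wienerLine ∂wienerLine =
      ∫⁻ ω₀, ∫⁻ ω, F x ω₀ y ω ∂wienerLine ∂wienerLine := by
    intro y
    have hm : Measurable fun q : (Fin 3 → (ℝ≥0 → ℝ)) × (Fin 3 → (ℝ≥0 → ℝ)) => F x q.2 y q.1 := by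
      have hc := hF.comp (f := fun q : (Fin 3 → (ℝ≥0 → ℝ)) × (Fin 3 → (ℝ≥0 → ℝ)) => ((x, q.2), (y, q.1)))
        ((measurable_const.prodMk measurable_snd).prodMk (measurable_const.prodMk measurable_fst))
      exact hc
    rw [lintegral_lintegral_swap hm.aemeasurable]
  -- (b) the `ω`-integral is jointly measurable in `(y, ω₀)`
  have hb : Measurable fun q : Space × (Fin 3 → (ℝ≥0 → ℝ)) => ∫⁻ ω, F x q.2 q.1 ω ∂wienerLine := by
    have hc := hF.comp
      (f := fun q : (Space × (Fin 3 → (ℝ≥0 → ℝ))) × (Fin 3 → (ℝ≥0 → ℝ)) => ((x, q.1.2), (q.1.1, q.2)))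
      ((measurable_const.prodMk (measurable_snd.comp measurable_fst)).prodMk
        ((measurable_fst.comp measurable_fst).prodMk measurable_snd))
    exact hc.lintegral_prod_right'
  -- (c) for each `ω₀`, the section `(y, ω) ↦ F x ω₀ y ω` is measurable
  have hc : ∀ ω₀ : Fin 3 → (ℝ≥0 → ℝ), Measurable fun q : Space × (Fin 3 → (ℝ≥0 → ℝ)) => F x ω₀ q.1 q.2 := by
    intro ω₀
    have hc := hF.comp (f := fun q : Space × (Fin 3 → (ℝ≥0 → ℝ)) => ((x, ω₀), q))
      (measurable_const.prodMk measurable_id)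
    exact hc
  refine (lintegral_congr ha).trans_le ?_
  rw [lintegral_lintegral_swap hb.aemeasurable]
  refine lintegral_mono fun ω₀ => ?_
  rw [lintegral_lintegral_swap (hc ω₀).aemeasurable]
  exact lintegral_mono fun ω => hB ω₀ ω

/-- **Finitely many slices.** For jointly measurable `F k : (x, ω₀, y, ω) ↦ [0,∞]`, `k < M`, with
`∫ F k x ω₀ y ω dy ≤ B k ω₀ ω`:
`∫ dy ∫ dW(ω) ∫ dW(ω₀) Σ_{k<M} F k ≤ Σ_{k<M} ∫ dW(ω₀) ∫ dW(ω) B k`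
(the finite sum commutes with the three integrals, `lintegral_finsetSum`; then slice by slice
`lintegral_le_of_lintegral_le`). -/
theorem lintegral_sum_le
    (F : ℕ → Space → (Fin 3 → (ℝ≥0 → ℝ)) → Space → (Fin 3 → (ℝ≥0 → ℝ)) → ℝ≥0∞)
    (hF : ∀ k, Measurable fun q : (Space × (Fin 3 → (ℝ≥0 → ℝ))) × (Space × (Fin 3 → (ℝ≥0 → ℝ))) =>
      F k q.1.1 q.1.2 q.2.1 q.2.2)
    (B : ℕ → (Fin 3 → (ℝ≥0 → ℝ)) → (Fin 3 → (ℝ≥0 → ℝ)) → ℝ≥0∞) (x : Space)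
    (hB : ∀ k ω₀ ω, ∫⁻ y, F k x ω₀ y ω ≤ B k ω₀ ω) (M : ℕ) :
    ∫⁻ y, ∫⁻ ω, ∫⁻ ω₀, (∑ k ∈ Finset.range M, F k x ω₀ y ω) ∂wienerLine ∂wienerLine ≤
      ∑ k ∈ Finset.range M, ∫⁻ ω₀, ∫⁻ ω, B k ω₀ ω ∂wienerLine ∂wienerLine := by
  -- sections of `F k`, all from the joint measurability
  have h1 : ∀ (k : ℕ) (y : Space) (ω : Fin 3 → (ℝ≥0 → ℝ)),
      Measurable fun ω₀ : Fin 3 → (ℝ≥0 → ℝ) => F k x ω₀ y ω := by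
    intro k y ω
    have hc := (hF k).comp (f := fun ω₀ : Fin 3 → (ℝ≥0 → ℝ) => ((x, ω₀), (y, ω)))
      ((measurable_const.prodMk measurable_id).prodMk measurable_const)
    exact hc
  have h2 : ∀ (k : ℕ) (y : Space),
      Measurable fun ω : Fin 3 → (ℝ≥0 → ℝ) => ∫⁻ ω₀, F k x ω₀ y ω ∂wienerLine := by
    intro k y
    have hc := (hF k).comp
      (f := fun q : (Fin 3 → (ℝ≥0 → ℝ)) × (Fin 3 → (ℝ≥0 → ℝ)) => ((x, q.2), (y, q.1)))
      ((measurable_const.prodMk measurable_snd).prodMk (measurable_const.prodMk measurable_fst))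
    exact hc.lintegral_prod_right'
  have h3 : ∀ k : ℕ, Measurable fun y : Space => ∫⁻ ω, ∫⁻ ω₀, F k x ω₀ y ω ∂wienerLine ∂wienerLine := by
    intro k
    have hc := (hF k).comp
      (f := fun q : (Space × (Fin 3 → (ℝ≥0 → ℝ))) × (Fin 3 → (ℝ≥0 → ℝ)) => ((x, q.2), q.1))
      ((measurable_const.prodMk measurable_snd).prodMk measurable_fst)
    exact (hc.lintegral_prod_right').lintegral_prod_right'
  -- pull the finite sum out of the three integrals
  have e1 : ∀ (y : Space) (ω : Fin 3 → (ℝ≥0 → ℝ)),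
      ∫⁻ ω₀, (∑ k ∈ Finset.range M, F k x ω₀ y ω) ∂wienerLine =
        ∑ k ∈ Finset.range M, ∫⁻ ω₀, F k x ω₀ y ω ∂wienerLine :=
    fun y ω => lintegral_finsetSum _ fun k _ => h1 k y ω
  have e2 : ∀ y : Space, ∫⁻ ω, ∫⁻ ω₀, (∑ k ∈ Finset.range M, F k x ω₀ y ω) ∂wienerLine ∂wienerLine =
      ∑ k ∈ Finset.range M, ∫⁻ ω, ∫⁻ ω₀, F k x ω₀ y ω ∂wienerLine ∂wienerLine := by
    intro y
    rw [lintegral_congr (e1 y)]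
    exact lintegral_finsetSum _ fun k _ => h2 k y
  have e3 : ∫⁻ y, ∫⁻ ω, ∫⁻ ω₀, (∑ k ∈ Finset.range M, F k x ω₀ y ω) ∂wienerLine ∂wienerLine =
      ∑ k ∈ Finset.range M, ∫⁻ y, ∫⁻ ω, ∫⁻ ω₀, F k x ω₀ y ω ∂wienerLine ∂wienerLine := by
    rw [lintegral_congr e2]
    exact lintegral_finsetSum _ fun k _ => h3 k
  rw [e3]
  exact Finset.sum_le_sum fun k _ => lintegral_le_of_lintegral_le (F k) (hF k) (B k) x (hB k)

/-! ### The ball volume, whatever the centre -/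

/-- `∫ 𝟙_{B(z, r)}(y) dy = |B(z, r)| ≤ (2r)³` in `ℝ³` for `r ≥ 0`, for EVERY centre `z`
(`Insertion.volume_closedBall_le`; this is why the moving centres of the slices cost nothing). -/
theorem lintegral_indicator_closedBall_le (z : Space) {r : ℝ} (hr : 0 ≤ r) :
    ∫⁻ y, (Metric.closedBall z r).indicator (fun _ => (1 : ℝ≥0∞)) y ≤ ENNReal.ofReal ((2 * r) ^ 3) := by
  rw [lintegral_indicator Metric.isClosed_closedBall.measurableSet, setLIntegral_const, one_mul]
  exact volume_closedBall_le z hr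

end Summit.AtomisticToContinuum.BoseEinsteinCondensation.Cruxes.TwoReplicaTransienceBound.TracerDecoupling.SlicedPenalty

namespace Summit.AtomisticToContinuum.BoseEinsteinCondensation.Cruxes.TwoReplicaTransienceBound.TracerDecoupling

open Literature.MathematicalPhysics.QuantumManyBody.BoseGas
open Literature.Probability.Process (brownian incRunSup)

/-- **Registered stub `stub_slicedPenaltyMeasurable`** (crux stmt-AtomisticToContinuum-9687, line
`SketchIdeator1` v7): the sliced penalty `Σ_{k<M} 𝟙{y ∈ B(x + √2 b_{kh}(ω₀) - √2 b_{kh}(ω), R + √2(S_k(ω₀) + S_k(ω)))}`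
is jointly measurable in `(x, ω₀, y, ω)` (finite sum of `SlicedPenalty.measurable_slicePenalty`). -/
theorem stub_slicedPenaltyMeasurable :
    ∀ (R : ℝ) (h : ℝ≥0) (M : ℕ),
      Measurable fun q : (Space × (Fin 3 → (ℝ≥0 → ℝ))) × (Space × (Fin 3 → (ℝ≥0 → ℝ))) =>
        ∑ k ∈ Finset.range M,
          (Metric.closedBall
            (q.1.1 + WithLp.toLp 2 (fun c : Fin 3 => Real.sqrt 2 * brownian ((k : ℝ≥0) * h) (q.1.2 c)) -
              WithLp.toLp 2 (fun c : Fin 3 => Real.sqrt 2 * brownian ((k : ℝ≥0) * h) (q.2.2 c)))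
            (R + Real.sqrt 2 * ((∑ c, incRunSup ((k : ℝ≥0) * h) h (q.1.2 c)) +
              ∑ c, incRunSup ((k : ℝ≥0) * h) h (q.2.2 c)))).indicator (fun _ => (1 : ℝ≥0∞)) q.2.1 := by
  intro R h M
  exact Finset.measurable_sum _ fun k _ => SlicedPenalty.measurable_slicePenalty R ((k : ℝ≥0) * h) h

/-- **Registered stub `stub_slicedPenaltyIntegral`** (crux stmt-AtomisticToContinuum-9687, line
`SketchIdeator1` v7): the error functional of the sliced penalty is a sum of ball volumes,
`∫ dy ∫ dW(ω) ∫ dW(ω₀) Σ_{k<M} 𝟙_{B_k}(y) ≤ Σ_{k<M} E_{ω₀,ω}[(2(R + √2(S_k(ω₀) + S_k(ω))))³]`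
(`SlicedPenalty.lintegral_sum_le`: the sum commutes with the integrals and Tonelli integrates `y` first;
`SlicedPenalty.lintegral_indicator_closedBall_le`: `|B(z, r)| ≤ (2r)³` whatever the moving centre `z`). -/
theorem stub_slicedPenaltyIntegral :
    ∀ (R : ℝ), 0 ≤ R → ∀ (h : ℝ≥0) (M : ℕ) (x : Space),
      ∫⁻ y, ∫⁻ ω, ∫⁻ ω₀,
        (∑ k ∈ Finset.range M,
          (Metric.closedBall
            (x + WithLp.toLp 2 (fun c : Fin 3 => Real.sqrt 2 * brownian ((k : ℝ≥0) * h) (ω₀ c)) -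
              WithLp.toLp 2 (fun c : Fin 3 => Real.sqrt 2 * brownian ((k : ℝ≥0) * h) (ω c)))
            (R + Real.sqrt 2 * ((∑ c, incRunSup ((k : ℝ≥0) * h) h (ω₀ c)) +
              ∑ c, incRunSup ((k : ℝ≥0) * h) h (ω c)))).indicator (fun _ => (1 : ℝ≥0∞)) y)
        ∂wienerLine ∂wienerLine ≤
      ∑ k ∈ Finset.range M, ∫⁻ ω₀, ∫⁻ ω, ENNReal.ofReal ((2 * (R + Real.sqrt 2 *
          ((∑ c, incRunSup ((k : ℝ≥0) * h) h (ω₀ c)) + ∑ c, incRunSup ((k : ℝ≥0) * h) h (ω c)))) ^ 3)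
        ∂wienerLine ∂wienerLine := by
  intro R hR h M x
  exact SlicedPenalty.lintegral_sum_le
    (fun (k : ℕ) (x' : Space) (ω₀ : Fin 3 → (ℝ≥0 → ℝ)) (y : Space) (ω : Fin 3 → (ℝ≥0 → ℝ)) =>
      (Metric.closedBall
        (x' + WithLp.toLp 2 (fun c : Fin 3 => Real.sqrt 2 * brownian ((k : ℝ≥0) * h) (ω₀ c)) -
          WithLp.toLp 2 (fun c : Fin 3 => Real.sqrt 2 * brownian ((k : ℝ≥0) * h) (ω c)))
        (R + Real.sqrt 2 * ((∑ c, incRunSup ((k : ℝ≥0) * h) h (ω₀ c)) +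
          ∑ c, incRunSup ((k : ℝ≥0) * h) h (ω c)))).indicator (fun _ => (1 : ℝ≥0∞)) y)
    (fun k => SlicedPenalty.measurable_slicePenalty R ((k : ℝ≥0) * h) h)
    (fun (k : ℕ) (ω₀ ω : Fin 3 → (ℝ≥0 → ℝ)) => ENNReal.ofReal ((2 * (R + Real.sqrt 2 *
      ((∑ c, incRunSup ((k : ℝ≥0) * h) h (ω₀ c)) + ∑ c, incRunSup ((k : ℝ≥0) * h) h (ω c)))) ^ 3))
    x (fun k ω₀ ω => SlicedPenalty.lintegral_indicator_closedBall_le _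
      (SlicedPenalty.sliceRadius_nonneg hR ((k : ℝ≥0) * h) h ω₀ ω)) M

end Summit.AtomisticToContinuum.BoseEinsteinCondensation.Cruxes.TwoReplicaTransienceBound.TracerDecoupling

end
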